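import Literature.AlgebraicGeometry.Motives.AbelianVarietyRelFrobeniusFactorisation
import Literature.AlgebraicGeometry.Motives.AbelianVarietyTangentCotangentBridge
import Literature.AlgebraicGeometry.Motives.AbelianVarietyTorsionCubeProofs
import HarnessLib

/-!
# The Verschiebung of an abelian variety: `[p] = F_{A/k} ≫ V`, and over `𝔽_q`: `π ≫ V = [q] = V ≫ π`

Topic `Literature/AlgebraicGeometry/Motives`, namespace `Literature.AlgebraicGeometry.Motives.AbelianVariety`.
THEOREMS ONLY (no definition, no named fact, no instance, no notation; net Literature debt **0**).
Cell `hodgecm-mathlib` (D-0151), FLOOR-0 P5a (D9op road 2′, sub-line `Cruxes/HLiu418/Lines/F0_D9opRoad2`):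
the generic «(Ver)» input `V * π = q` of the Verschiebung door
`GoodReductionAt.pinned_eichlerShimura_of_honest` (★ `Motives/AbelianVarietyEichlerShimuraPinTransport`) and the
`Frob^! ∘ Alb(Frob) = q` step of the special-fibre computation of the Hecke correspondence `T_{w,1}` on the
component `T⁻` ([Liu2021] proof of Cor. D.9, p. 139; [DiamondShurman2005] Thm. 8.7.2 «`T̃_p = F + ⟨p⟩V`»).

## Mathematics

Let `A` be an abelian variety over a field `K` of characteristic `p > 0`.

* §1. `[n]_A` is dominant for `n ≠ 0` (it is an isogeny, ★ `isIsogeny_zsmul_id_holds`); if `n = 0` in `K`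
  then `[n]_A` KILLS THE TANGENT SPACE at the origin, with values in any field `L ⊇ K`: its cotangent map is
  the scalar `n = 0` (★ `cotangentMap_zsmul_id_eq_smul`, [GortzWedhorn2023] proof of Prop. 27.187), and a
  homomorphism with zero cotangent map kills every `L[ε]`-point at the origin
  (★ `forall_tangent_comp_eq_one_of_cotangentMap_end_eq_zero`, [GortzWedhorn2023] Rem. 27.18).
* §2. For `K` PERFECT: every rational function pulled back by `[p^r]_A` is a `p^r`-th power in `K(A)`
  (induction on `r`: `[p]^♯ b ∈ K(A)^p` by Shimura's «`δλ = 0 ⇒ k(λx) ⊆ k(x^p)`», ★ `exists_pow_eq_functionFieldMap`,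
  [Shimura1998] §2.8 Thm. 1 / Prop. 6 (i)), hence **`[p^r]_A = F_{A/K}^{(r)} ≫ V` for a UNIQUE homomorphism
  `V : A^{(p^r)} → A`** — the (iterated) VERSCHIEBUNG — by the rational-factor lemma
  ★ `existsUnique_fac_relFrobenius_of_forall_exists_pow_eq` ([Shimura1998] §2.8 Prop. 6 (i);
  [EdixhovenVanDerGeerMoonenAV] Ch. 5 §2 «`V_{X/k} ∘ F_{X/k} = [p]_X`»; [GortzWedhorn2023] Prop. 27.182 for
  `F_{A/K}` an isogeny of degree `p^{dim A}`).
* §3. For `K` FINITE with `q = #K = p^r` elements the `q`-Frobenius ENDOMORPHISM `π_A` (★ `frobeniusHom`,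
  the `q`-power map, [Tate1966Endomorphisms] §1) pulls rational functions back to their `q`-th powers
  (★ `functionFieldMap_powEndo`), so `[q]^♯ K(A) ⊆ K(A)^q = π^♯ K(A)` and the rational-factor lemma
  ★ `existsUnique_fac_hom_of_range_functionFieldMap_le` ([Milne1986AbelianVarieties] §3 Thm. 3.1 + rigidity)
  gives a UNIQUE endomorphism `V` with **`π ≫ V = [q]_A`**; since `π` is central (★ `frobeniusHom_comp`) also
  **`V ≫ π = [q]_A`**.  In the ring `End A` (Mathlib's `f * g = g ≫ f`): `V * π = q = π * V`
  (`exists_verschiebung`) — the integral form of [Milne1986AbelianVarieties] §19 Lemma 19.2 «`π_A† ∘ π_A = q_A`»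
  (there `π† = q/π` in `End⁰(A)` through a Rosati involution; here `q/π ∈ End(A)` itself, no polarisation).

Everything is proved; the only inputs are tree theorems.  HC_CM is proved only modulo the printed citations until
rung 0 closes; this file adds no hypothesis.

## References
* [Shimura1998] G. Shimura, *Abelian Varieties with Complex Multiplication and Modular Functions* (1998), §2.8
  Thm. 1 and Prop. 6 (i) (pp. 15–16); §18.6 proof of Thm. 18.6 (pp. 127–128: «`π = ψ ∘ λ̃`»).
* [EdixhovenVanDerGeerMoonenAV] B. Edixhoven, G. van der Geer, B. Moonen, *Abelian Varieties* (book draft),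
  Ch. 5 §2 (relative Frobenius and Verschiebung, `V ∘ F = [p]`, `F ∘ V = [p]`).
* [GortzWedhorn2023] U. Görtz, T. Wedhorn, *Algebraic Geometry II* (2023), Prop. 27.182 (p. 885: `F_G` is an isogeny
  with kernel of degree `p^{dim G_s}`), Rem. 27.18 (tangent map), proof of Prop. 27.187 (`Lie([n]) = n`).
* [Milne1986AbelianVarieties] J. S. Milne, *Abelian Varieties* (Cornell–Silverman 1986), §3 Thm. 3.1, §19 Lemma 19.2
  (p. 145: «`π_A† ∘ π_A = q_A`»).
* [Tate1966Endomorphisms] J. Tate, *Endomorphisms of abelian varieties over finite fields*, Invent. Math. 2 (1966), §1.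
* [Liu2021] Y. Liu, *Fourier–Jacobi cycles and arithmetic relative trace formula*, Camb. J. Math. 9 (2021), App. D,
  proof of Cor. D.9 (p. 139).
* [DiamondShurman2005] F. Diamond, J. Shurman, *A First Course in Modular Forms*, Thm. 8.7.2 (p. 353).
-/

set_option autoImplicit false

noncomputable section

universe u

open CategoryTheory AlgebraicGeometry TrivSqZeroExt
open scoped MonObj

namespace Literature.AlgebraicGeometry.Motives

namespace AbelianVariety

open AlgPoints

variable {K : Type u} [Field K]

/-! ## §1 `[n]` is dominant; `[n]` kills the tangent space when `n = 0` in `K` -/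

/-- **`[n]_A` is dominant for `n ≠ 0`** (any characteristic): it is an isogeny (★ `isIsogeny_zsmul_id_holds`,
[GortzWedhorn2023] Prop. 27.186), in particular surjective. [cite: GortzWedhorn2023, Prop. 27.186 (p. 887)] -/
theorem isDominant_toSchemeHom_zsmul_id (A : AbelianVariety K) {n : ℤ} (hn : n ≠ 0) :
    IsDominant (Hom.toSchemeHom (n • 𝟙 A)) :=
  ⟨(isIsogeny_zsmul_id_holds A n hn).1.1.denseRange⟩

/-- **If `n = 0` in `K` then `[n]_A` kills the tangent space at the origin** (with values in any field
`L ⊇ K`): every `L[ε]`-point `t` of `A` at the origin satisfies `t ≫ [n] = 1`.  The cotangent map of `[n]` is the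
scalar `n` ([GortzWedhorn2023] proof of Prop. 27.187, ★ `cotangentMap_zsmul_id_eq_smul`), here `0`, and a
homomorphism with zero cotangent map kills the `L[ε]`-points at the origin ([GortzWedhorn2023] Rem. 27.18 (1), (4),
★ `forall_tangent_comp_eq_one_of_cotangentMap_end_eq_zero`).  In characteristic `p` this applies to `n = p`:
«`δ[p] = 0`» ([Shimura1998] §2.8). [cite: GortzWedhorn2023, Rem. 27.18 (1) and (4) (pp. 805–806); proof of Prop. 27.187 (p. 888)]
[cite: Shimura1998, §2.8 Prop. 6 (i) (p. 16)] -/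
theorem tangent_comp_zsmul_id_eq_one_of_cast_eq_zero {A : AbelianVariety K} {n : ℤ} (hn : (n : K) = 0)
    (L : Type u) [Field L] [Algebra K L]
    (t : specOver K (DualNumber L) ⟶ A.X) (ht : specOverMapOfAlgHom (fstHom K L L) ≫ t = 1) :
    t ≫ (n • 𝟙 A).hom.hom.hom = 1 :=
  forall_tangent_comp_eq_one_of_cotangentMap_end_eq_zero L (n • 𝟙 A)
    (by rw [cotangentMap_zsmul_id_eq_smul, hn, zero_smul]) t ht

/-! ## §2 Over a perfect field: `[p^r]^♯ K(A) ⊆ K(A)^{p^r}`, hence `[p^r] = F_{A/K}^{(r)} ≫ V` -/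

/-- Transport of `functionFieldMap` along an equality of (dominant) morphisms. [folklore] -/
private theorem functionFieldMap_congr {X Y : Scheme.{u}} [IsIntegral X] [IsIntegral Y] {f g : X ⟶ Y}
    [IsDominant f] [IsDominant g] (h : f = g) : RatFn.functionFieldMap f = RatFn.functionFieldMap g := by
  subst h
  rfl

/-- `(p^r : ℤ) ≠ 0` for a prime `p`. [folklore] -/
private theorem natCast_prime_pow_ne_zero (p : ℕ) [Fact p.Prime] (r : ℕ) : ((p ^ r : ℕ) : ℤ) ≠ 0 := by
  exact_mod_cast pow_ne_zero r (Fact.out : p.Prime).ne_zero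

/-- **`[p^r]^♯ b` is a `p^r`-th power in `K(A)`** for every rational function `b` on an abelian variety `A` over a
perfect field `K` of characteristic `p` (stated for any dominant `f = [p^r]_A`, so that `f^♯` makes sense).
Induction on `r`: `[p^{r+1}] = [p^r] ≫ [p]`, `[p]^♯ b = c₁^p` since `[p]` kills the generic tangent vectors
(`tangent_comp_zsmul_id_eq_one_of_cast_eq_zero`, Shimura's «`δλ = 0 ⇒ k(λx) ⊆ k(x^p)`»,
★ `exists_pow_eq_functionFieldMap`), and `[p^r]^♯ (c₁^p) = ([p^r]^♯ c₁)^p = c₂^{p^{r+1}}`.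
[cite: Shimura1998, §2.8 Thm. 1 (p. 15) and Prop. 6 (i) (p. 16)] -/
theorem exists_pow_eq_functionFieldMap_of_eq_pow_zsmul_id [PerfectField K] (p : ℕ) [Fact p.Prime] [CharP K p]
    (A : AbelianVariety K) (r : ℕ) (f : A ⟶ A) [IsDominant (Hom.toSchemeHom f)]
    (hf : f = ((p ^ r : ℕ) : ℤ) • 𝟙 A) (b : A.X.left.functionField) :
    ∃ c : A.X.left.functionField, c ^ p ^ r = RatFn.functionFieldMap (Hom.toSchemeHom f) b := by
  induction r generalizing f b with
  | zero =>
    refine ⟨b, ?_⟩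
    haveI : IsDominant (𝟙 A.X.left) := by
      refine ⟨?_⟩
      have hs : Function.Surjective (𝟙 A.X.left : A.X.left ⟶ A.X.left).base := fun x => ⟨x, rfl⟩
      exact hs.denseRange
    have h1 : Hom.toSchemeHom f = 𝟙 A.X.left := by
      rw [hf, pow_zero, Nat.cast_one, one_smul]
      rfl
    rw [pow_zero, pow_one, functionFieldMap_congr h1, RatFn.functionFieldMap_id]
    rfl
  | succ r ih =>
    -- `[p^{r+1}] = [p^r] ≫ [p]`
    set g : A ⟶ A := ((p ^ r : ℕ) : ℤ) • 𝟙 A with hg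
    set h : A ⟶ A := ((p : ℕ) : ℤ) • 𝟙 A with hh
    haveI hgd : IsDominant (Hom.toSchemeHom g) := A.isDominant_toSchemeHom_zsmul_id (natCast_prime_pow_ne_zero p r)
    haveI hhd : IsDominant (Hom.toSchemeHom h) :=
      A.isDominant_toSchemeHom_zsmul_id (by exact_mod_cast (Fact.out : p.Prime).ne_zero)
    haveI : IsDominant (Hom.toSchemeHom g ≫ Hom.toSchemeHom h) := inferInstance
    have hfgh : Hom.toSchemeHom f = Hom.toSchemeHom g ≫ Hom.toSchemeHom h := by
      have e : f = g ≫ h := by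
        rw [hf, hg, hh, Preadditive.zsmul_comp, Preadditive.comp_zsmul, Category.id_comp, smul_smul,
          ← Nat.cast_mul, pow_succ]
      rw [e]
      rfl
    -- `[p]^♯ b = c₁^p`: `[p]` kills the generic tangent vectors
    obtain ⟨c₁, hc₁⟩ := exists_pow_eq_functionFieldMap p rfl h
      (fun t ht => tangent_comp_zsmul_id_eq_one_of_cast_eq_zero
        (by rw [Int.cast_natCast]; exact CharP.cast_eq_zero K p) _ t ht) b
    -- `[p^r]^♯ c₁ = c₂^{p^r}`
    obtain ⟨c₂, hc₂⟩ := ih g rfl c₁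
    refine ⟨c₂, ?_⟩
    rw [functionFieldMap_congr hfgh, RatFn.functionFieldMap_comp, RingHom.comp_apply, ← hc₁, map_pow, ← hc₂,
      ← pow_mul, pow_succ]

/-- **The (iterated) Verschiebung `V : A^{(p^r)} → A`, `F_{A/K}^{(r)} ≫ V = [p^r]_A`** — for an abelian variety `A`
over a perfect field `K` of characteristic `p`, the multiplication `[p^r]` factors UNIQUELY through the relative
`p^r`-Frobenius `A.relFrobenius p r : A ⟶ A.frobeniusTwist p r` (the rational-factor lemma
★ `existsUnique_fac_relFrobenius_of_forall_exists_pow_eq`: `[p^r]^♯ K(A) ⊆ K(A)^{p^r} = F^♯ K(A^{(p^r)})`).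
For `r = 1` the factor is the Verschiebung `V_{A/K}` with `V ∘ F = [p]` ([EdixhovenVanDerGeerMoonenAV] Ch. 5 §2);
`F_{A/K}` is an isogeny of degree `p^{dim A}` ([GortzWedhorn2023] Prop. 27.182).
[cite: Shimura1998, §2.8 Prop. 6 (i) (p. 16); §18.6 proof of Thm. 18.6 (pp. 127–128)]
[cite: EdixhovenVanDerGeerMoonenAV, Ch. 5 §2 (Verschiebung, `V ∘ F = [p]`)] [cite: GortzWedhorn2023, Prop. 27.182 (p. 885)] -/
theorem existsUnique_relFrobenius_comp_eq_pow_zsmul_id [PerfectField K] (p : ℕ) [Fact p.Prime] [CharP K p]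
    (A : AbelianVariety K) (r : ℕ) :
    ∃! V : A.frobeniusTwist p r ⟶ A, A.relFrobenius p r ≫ V = ((p ^ r : ℕ) : ℤ) • 𝟙 A := by
  haveI := A.isDominant_toSchemeHom_zsmul_id (natCast_prime_pow_ne_zero p r)
  exact existsUnique_fac_relFrobenius_of_forall_exists_pow_eq p r _ fun b =>
    A.exists_pow_eq_functionFieldMap_of_eq_pow_zsmul_id p r _ rfl b

/-- The Verschiebung proper (`r = 1`): **`F_{A/K} ≫ V = [p]_A` for a unique `V : A^{(p)} → A`**.
[cite: EdixhovenVanDerGeerMoonenAV, Ch. 5 §2 (Verschiebung, `V ∘ F = [p]`)] [cite: Shimura1998, §2.8 Prop. 6 (i) (p. 16)] -/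
theorem existsUnique_relFrobenius_one_comp_eq_zsmul_id [PerfectField K] (p : ℕ) [Fact p.Prime] [CharP K p]
    (A : AbelianVariety K) :
    ∃! V : A.frobeniusTwist p 1 ⟶ A, A.relFrobenius p 1 ≫ V = (p : ℤ) • 𝟙 A := by
  simpa only [pow_one] using A.existsUnique_relFrobenius_comp_eq_pow_zsmul_id p 1

/-! ## §3 Over a finite field: `π ≫ V = [q] = V ≫ π` -/

section Finite

variable [Finite K] (A : AbelianVariety K)

/-- The `q`-Frobenius endomorphism `π_A` is dominant (it is the identity on points). [cite: Tate1966Endomorphisms, §1] -/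
theorem isDominant_toSchemeHom_frobeniusHom : IsDominant (Hom.toSchemeHom (frobeniusHom A)) := by
  rw [toSchemeHom_frobeniusHom]
  exact isDominant_powEndo _ _ _ _

/-- **`π^♯ c = c^q` on `K(A)`** (`q = #K`): the Frobenius endomorphism is the `q`-power map on functions
(★ `functionFieldMap_powEndo`). [cite: Tate1966Endomorphisms, §1] -/
theorem functionFieldMap_frobeniusHom [IsDominant (Hom.toSchemeHom (frobeniusHom A))] (c : A.X.left.functionField) :
    RatFn.functionFieldMap (Hom.toSchemeHom (frobeniusHom A)) c = c ^ Nat.card K :=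
  functionFieldMap_powEndo A.X.left (Nat.card K) card_ne_zero (add_pow_card_sections A.X) _
    (toSchemeHom_frobeniusHom A) c

/-- `#K = p^r` for the characteristic `p` of the finite field `K`. [folklore] -/
private theorem exists_natCard_eq_ringChar_pow : ∃ r : ℕ, Nat.card K = ringChar K ^ r := by
  letI := Fintype.ofFinite K
  obtain ⟨r, -, hr⟩ := FiniteField.card K (ringChar K)
  exact ⟨r, by rw [Nat.card_eq_fintype_card, hr]⟩

/-- **`π ≫ V = [q]_A` for a UNIQUE endomorphism `V` of `A`** (`K` finite with `q` elements, `π = π_A` the `q`-Frobenius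
endomorphism): `[q]^♯ K(A) ⊆ K(A)^q` (§2 with `q = p^r`) `= π^♯ K(A)` (`functionFieldMap_frobeniusHom`), so `[q]`
factors uniquely through the dominant `π` (★ `existsUnique_fac_hom_of_range_functionFieldMap_le`).  `V` is the `r`-fold
Verschiebung read through `A^{(q)} = A`; it is «`q/π`», integral in `End(A)` ([Milne1986AbelianVarieties] Lemma 19.2
gives `π† ∘ π = q` in `End⁰(A)` for a Rosati involution). [cite: Milne1986AbelianVarieties, §19 Lemma 19.2 (p. 145) and §3 Thm. 3.1]
[cite: EdixhovenVanDerGeerMoonenAV, Ch. 5 §2 (Verschiebung, `V ∘ F = [p]`)] [cite: Shimura1998, §2.8 Prop. 6 (i) (p. 16)] -/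
theorem existsUnique_frobeniusHom_comp_eq_card_zsmul_id :
    ∃! V : A ⟶ A, frobeniusHom A ≫ V = (Nat.card K : ℤ) • 𝟙 A := by
  -- `q = p^r`
  obtain ⟨r, hr⟩ := exists_natCard_eq_ringChar_pow (K := K)
  have hp : (ringChar K).Prime := (CharP.char_is_prime_or_zero K (ringChar K)).resolve_right
    (CharP.char_ne_zero_of_finite K (ringChar K))
  haveI : Fact (ringChar K).Prime := ⟨hp⟩
  haveI := A.isDominant_toSchemeHom_zsmul_id (n := (Nat.card K : ℤ)) (by exact_mod_cast (card_ne_zero (k := K)))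
  haveI := A.isDominant_toSchemeHom_frobeniusHom
  refine A.existsUnique_fac_hom_of_range_functionFieldMap_le (frobeniusHom A) ((Nat.card K : ℤ) • 𝟙 A) ?_
  rintro _ ⟨b, rfl⟩
  have hq : ((Nat.card K : ℕ) : ℤ) • 𝟙 A = ((ringChar K ^ r : ℕ) : ℤ) • 𝟙 A := by rw [hr]
  obtain ⟨c, hc⟩ := A.exists_pow_eq_functionFieldMap_of_eq_pow_zsmul_id (ringChar K) r _ hq b
  exact ⟨c, by rw [functionFieldMap_frobeniusHom, show c ^ Nat.card K = c ^ ringChar K ^ r by rw [hr], hc]⟩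

/-- **`π ≫ V = [q]_A` and `V ≫ π = [q]_A`**: the Verschiebung of `existsUnique_frobeniusHom_comp_eq_card_zsmul_id`
also satisfies `V ≫ π = [q]`, because `π` commutes with every homomorphism (★ `frobeniusHom_comp`,
[Tate1966Endomorphisms] §1). [cite: Tate1966Endomorphisms, §1] [cite: Milne1986AbelianVarieties, §19 Lemma 19.2 (p. 145)] -/
theorem exists_frobeniusHom_comp_eq_card_zsmul_id :
    ∃ V : A ⟶ A, frobeniusHom A ≫ V = (Nat.card K : ℤ) • 𝟙 A ∧ V ≫ frobeniusHom A = (Nat.card K : ℤ) • 𝟙 A := by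
  obtain ⟨V, hV, -⟩ := A.existsUnique_frobeniusHom_comp_eq_card_zsmul_id
  exact ⟨V, hV, by rw [← frobeniusHom_comp, hV]⟩

/-- **The Verschiebung in the ring `End A`: `V * π = q` and `π * V = q`** (`q = #K`; Mathlib's `End A` has
`f * g = g ≫ f`, and `(q : End A) = q • 𝟙 A`).  This is the «(Ver)» hypothesis `hV` of
★ `GoodReductionAt.pinned_eichlerShimura_of_honest` for the reduction `Ā = R.reduction` of an abelian variety with
good reduction, once `q` is read as `Nat.card κ(v)`. [cite: Milne1986AbelianVarieties, §19 Lemma 19.2 (p. 145)]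
[cite: EdixhovenVanDerGeerMoonenAV, Ch. 5 §2 (Verschiebung, `V ∘ F = [p]`)] [cite: Tate1966Endomorphisms, §1] -/
theorem exists_verschiebung :
    ∃ V : End A, V * End.of (frobeniusHom A) = (Nat.card K : End A) ∧ End.of (frobeniusHom A) * V = (Nat.card K : End A) := by
  obtain ⟨V, hV, hV'⟩ := A.exists_frobeniusHom_comp_eq_card_zsmul_id
  have hq : ((Nat.card K : ℤ) • 𝟙 A : A ⟶ A) = ((Nat.card K : End A) : A ⟶ A) := by
    rw [natCast_zsmul, ← Nat.smul_one_eq_cast, End.one_def]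
    rfl
  refine ⟨V, ?_, ?_⟩
  · rw [End.mul_def]
    change frobeniusHom A ≫ V = _
    rw [hV, hq]
  · rw [End.mul_def]
    change V ≫ frobeniusHom A = _
    rw [hV', hq]

end Finite

end AbelianVariety

end Literature.AlgebraicGeometry.Motives

end
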